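import Summits.CriticalPhenomena.PercolationContinuityZ3.Theorems.PercNearOneGluingNoHeavyLowerTailSahiOneStepUniformThreshold
import HarnessLib

/-!
# Two-sided lumping — UPPER MONO-B: the upper-ball drift of a dominated event generated below the upper ball is nonpositive

Support file (prover prim-ineq-prove-3 gen 50; `--supports stmt-CriticalPhenomena-4575`; memo
`run/shared/lean/prim/prim-ineq-prove-3/FINDING-G50-TWO-SIDED-LUMPING.md`, §2.3 lemma S4 and its tool, upper-ball monotonicity).
No definitions, no named facts, no sorries, no `native_decide`.

This is the mirror image, for the UPPER Hamming ball `{r ≤ N_F}`, of gen 21's MONO-B (`drift_nonpos_of_dominated`, lower ball, `H`-generated events),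
needed by the two-sided lumping theorem (memo THEOREM TL): `Cov(A,B) ≥ μ(L)·Cov(A,B | L) + μ(U)·Cov(A,B | U)` for the lower ball `L` and the upper
ball `U` at uniform density.  Block `insert e F` (`e ∉ F`); an increasing event `B` which is
* **`e`-dominated**: `ω ∈ B`, `e ∈ ω`, `j ∈ F ∖ ω` ⟹ `(ω ∖ {e}) ∪ {j} ∈ B`, and
* **generated below level `r+1`** (the dual of `H`-generation): every `ω ∈ B` contains some `z ∈ B` with `#(insert e F ∩ z) ≤ r`.
Then the two sections `B¹ = {ω | insert e ω ∈ B} ⊇ B⁰ = {ω | ω ∖ {e} ∈ B}` AGREE on the upper region `{r ≤ N_F}`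
(`section_sdiff_mem_of_dominated_genBelow`), and by UPPER-BALL MONOTONICITY (`real_inter_upper_mul_le`: `k ↦ μ(U | k ≤ N_F)` is nondecreasing
for an increasing `U`, summed from the layer monotonicity `real_inter_layer_mul_le` of gen 18) the upper drift
`μ{r+1 ≤ N_F}·μ(B¹ ∩ {r ≤ N_F}) − μ{r ≤ N_F}·μ(B⁰ ∩ {r+1 ≤ N_F})` is `≤ 0` (`upperDrift_nonpos_of_dominated`).  Every product measure; no uniformity.
-/

noncomputable section

namespace Summit.CriticalPhenomena.PercolationContinuityZ3.Theorems

namespace SahiOneStep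

open MeasureTheory
open Literature.Probability.Percolation (DeterminedBy determinedBy_iff)
open Literature.Probability.LatticeModels (prodBernoulli)
open SahiE3Sections (determinedBy_section_insert determinedBy_section_sdiff)
open scoped Classical

variable {ι : Type*} [Fintype ι]

/-! ## The combinatorial core: the sections of a dominated event generated below `r+1` agree on `{r ≤ N_F}` -/

omit [Fintype ι] in
/-- **Upper MONO-B, core** (memo S4).  For an increasing, `e`-dominated event `B` generated below level `r+1` of `insert e F` (`e ∉ F`):
if `insert e ω ∈ B` and `r ≤ #(F ∩ ω)` then `ω ∖ {e} ∈ B`.  (Take a generator `z ⊆ insert e ω`, `z ∈ B`, `#(insert e F ∩ z) ≤ r`; if `e ∉ z` then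
`z ⊆ ω ∖ {e}`; otherwise `#(F ∩ z) < r ≤ #(F ∩ ω)` gives `j ∈ F ∩ ω ∖ z`, and trading `e` for `j` in `z` yields a member of `B` below `ω ∖ {e}`.) [this work] -/
theorem section_sdiff_mem_of_dominated_genBelow {F : Finset ι} {e : ι} (heF : e ∉ F) {r : ℕ} {B : Set (Set ι)} (hB : IsUpperSet B)
    (hdom : ∀ ω ∈ B, e ∈ ω → ∀ j ∈ F, j ∉ ω → (ω \ {e}) ∪ {j} ∈ B)
    (hgenb : ∀ ω ∈ B, ∃ z ∈ B, z ⊆ ω ∧ ((insert e F).filter (· ∈ z)).card ≤ r)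
    {ω : Set ι} (hω : insert e ω ∈ B) (hbig : r ≤ (F.filter (· ∈ ω)).card) :
    ω \ {e} ∈ B := by
  obtain ⟨z, hzB, hzsub, hzcard⟩ := hgenb _ hω
  by_cases hez : e ∈ z
  · -- `#(F ∩ z) + 1 = #(insert e F ∩ z) ≤ r ≤ #(F ∩ ω)`: some `j ∈ F ∩ ω` is missing from `z`
    have hcard : ((insert e F).filter (· ∈ z)).card = (F.filter (· ∈ z)).card + 1 := by
      rw [Finset.filter_insert, if_pos hez]
      exact Finset.card_insert_of_notMem fun h => heF (Finset.mem_filter.1 h).1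
    have hex : ∃ j ∈ F, j ∈ ω ∧ j ∉ z := by
      by_contra h
      push Not at h
      have hsub : F.filter (· ∈ ω) ⊆ F.filter (· ∈ z) := fun j hj => by
        rw [Finset.mem_filter] at hj ⊢
        exact ⟨hj.1, h j hj.1 hj.2⟩
      have := Finset.card_le_card hsub
      omega
    obtain ⟨j, hjF, hjω, hjz⟩ := hex
    have hje : j ≠ e := fun h => heF (h ▸ hjF)
    have h := hdom z hzB hez j hjF hjz
    refine hB ?_ h
    intro x hx
    rcases hx with ⟨hxz, hxe⟩ | hxj
    · rcases hzsub hxz with hxe' | hxω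
      · exact absurd hxe' hxe
      · exact ⟨hxω, hxe⟩
    · exact ⟨hxj ▸ hjω, fun hxe => hje (hxj ▸ hxe)⟩
  · refine hB ?_ hzB
    intro x hxz
    rcases hzsub hxz with hxe | hxω
    · exact absurd (hxe ▸ hxz) hez
    · exact ⟨hxω, fun hxe => hez (hxe ▸ hxz)⟩

omit [Fintype ι] in
/-- Consequently the two sections of `B` at `e` agree on the upper region `{k ≤ N_F}` for every `k ≥ r`. [this work] -/
theorem section_inter_upper_eq_of_dominated_genBelow {F : Finset ι} {e : ι} (heF : e ∉ F) {r : ℕ} {B : Set (Set ι)} (hB : IsUpperSet B)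
    (hdom : ∀ ω ∈ B, e ∈ ω → ∀ j ∈ F, j ∉ ω → (ω \ {e}) ∪ {j} ∈ B)
    (hgenb : ∀ ω ∈ B, ∃ z ∈ B, z ⊆ ω ∧ ((insert e F).filter (· ∈ z)).card ≤ r)
    {k : ℕ} (hk : r ≤ k) :
    {ω : Set ι | insert e ω ∈ B} ∩ {ω : Set ι | k ≤ (F.filter (· ∈ ω)).card} =
      {ω : Set ι | ω \ {e} ∈ B} ∩ {ω : Set ι | k ≤ (F.filter (· ∈ ω)).card} := by
  ext ω
  simp only [Set.mem_inter_iff, Set.mem_setOf_eq]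
  constructor
  · rintro ⟨h1, h2⟩
    exact ⟨section_sdiff_mem_of_dominated_genBelow heF hB hdom hgenb h1 (le_trans hk h2), h2⟩
  · rintro ⟨h0, h2⟩
    exact ⟨section_sdiff_subset_section_insert hB e h0, h2⟩

/-! ## Upper-ball monotonicity -/

omit [Fintype ι] in
/-- The upper region `{k ≤ N_F}` is the disjoint union of the layer `{N_F = k}` and `{k+1 ≤ N_F}`. [folklore] -/
theorem upper_eq_layer_union (F : Finset ι) (k : ℕ) :
    {ω : Set ι | k ≤ (F.filter (· ∈ ω)).card} =
      {ω : Set ι | (F.filter (· ∈ ω)).card = k} ∪ {ω : Set ι | k + 1 ≤ (F.filter (· ∈ ω)).card} := by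
  ext ω
  simp only [Set.mem_setOf_eq, Set.mem_union]
  omega

omit [Fintype ι] in
/-- The layer `{N_F = k}` and `{k+1 ≤ N_F}` are disjoint. [folklore] -/
theorem disjoint_layer_upper (F : Finset ι) (k : ℕ) :
    Disjoint {ω : Set ι | (F.filter (· ∈ ω)).card = k} {ω : Set ι | k + 1 ≤ (F.filter (· ∈ ω)).card} :=
  Set.disjoint_left.2 fun ω h1 h2 => by
    simp only [Set.mem_setOf_eq] at h1 h2
    omega

/-- Measure of `X ∩ {k ≤ N_F}` = measure of `X ∩ {N_F = k}` + measure of `X ∩ {k+1 ≤ N_F}`. [folklore] -/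
theorem real_inter_upper_succ (p : ι → unitInterval) (F : Finset ι) (X : Set (Set ι)) (k : ℕ) :
    (prodBernoulli p).real (X ∩ {ω : Set ι | k ≤ (F.filter (· ∈ ω)).card}) =
      (prodBernoulli p).real (X ∩ {ω : Set ι | (F.filter (· ∈ ω)).card = k}) +
        (prodBernoulli p).real (X ∩ {ω : Set ι | k + 1 ≤ (F.filter (· ∈ ω)).card}) := by
  rw [upper_eq_layer_union, Set.inter_union_distrib_left]
  exact measureReal_union ((disjoint_layer_upper F k).mono Set.inter_subset_right Set.inter_subset_right)
    MeasurableSet.of_discrete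

/-- Measure of `{k ≤ N_F}` = measure of `{N_F = k}` + measure of `{k+1 ≤ N_F}`. [folklore] -/
theorem real_upper_succ (p : ι → unitInterval) (F : Finset ι) (k : ℕ) :
    (prodBernoulli p).real {ω : Set ι | k ≤ (F.filter (· ∈ ω)).card} =
      (prodBernoulli p).real {ω : Set ι | (F.filter (· ∈ ω)).card = k} +
        (prodBernoulli p).real {ω : Set ι | k + 1 ≤ (F.filter (· ∈ ω)).card} := by
  have h := real_inter_upper_succ p F Set.univ k
  simp only [Set.univ_inter] at h
  exact h

/-- **Layer vs upper region**: for an increasing `F`-determined `U` and `j ≤ k`,  `μ(U ∩ {N_F = j})·μ{k ≤ N_F} ≤ μ(U ∩ {k ≤ N_F})·μ{N_F = j}`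
(sum the layer monotonicity `real_inter_layer_mul_le` over the layers `≥ k`; downward induction on `k` from the empty region above `#F`). [this work] -/
theorem real_inter_layer_mul_upper_le (p : ι → unitInterval) (F : Finset ι) {U : Set (Set ι)} (hU : IsUpperSet U)
    (hUF : DeterminedBy U (↑F : Set ι)) (j k : ℕ) (hjk : j ≤ k) :
    (prodBernoulli p).real (U ∩ {ω : Set ι | (F.filter (· ∈ ω)).card = j}) *
        (prodBernoulli p).real {ω : Set ι | k ≤ (F.filter (· ∈ ω)).card} ≤
      (prodBernoulli p).real (U ∩ {ω : Set ι | k ≤ (F.filter (· ∈ ω)).card}) *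
        (prodBernoulli p).real {ω : Set ι | (F.filter (· ∈ ω)).card = j} := by
  -- downward induction: `d = #F + 1 - k`
  suffices h : ∀ d k : ℕ, F.card + 1 - k ≤ d → j ≤ k →
      (prodBernoulli p).real (U ∩ {ω : Set ι | (F.filter (· ∈ ω)).card = j}) *
          (prodBernoulli p).real {ω : Set ι | k ≤ (F.filter (· ∈ ω)).card} ≤
        (prodBernoulli p).real (U ∩ {ω : Set ι | k ≤ (F.filter (· ∈ ω)).card}) *
          (prodBernoulli p).real {ω : Set ι | (F.filter (· ∈ ω)).card = j} from
    h (F.card + 1 - k) k le_rfl hjk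
  intro d
  induction d with
  | zero =>
    intro k hk _
    have hlt : F.card < k := by omega
    rw [threshold_eq_empty_of_card_lt F hlt, Set.inter_empty, measureReal_empty, mul_zero, zero_mul]
  | succ d ih =>
    intro k hk hjk'
    rw [real_inter_upper_succ, real_upper_succ, mul_add, add_mul]
    exact add_le_add (real_inter_layer_mul_le p F hU hUF hjk') (ih (k + 1) (by omega) (by omega))

/-- **UPPER-BALL MONOTONICITY**: for an increasing `F`-determined `U`,  `μ(U ∩ {k ≤ N_F})·μ{k+1 ≤ N_F} ≤ μ(U ∩ {k+1 ≤ N_F})·μ{k ≤ N_F}`,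
i.e. `μ(U | k ≤ N_F) ≤ μ(U | k+1 ≤ N_F)` (any product measure). [this work] -/
theorem real_inter_upper_mul_le (p : ι → unitInterval) (F : Finset ι) {U : Set (Set ι)} (hU : IsUpperSet U)
    (hUF : DeterminedBy U (↑F : Set ι)) (k : ℕ) :
    (prodBernoulli p).real (U ∩ {ω : Set ι | k ≤ (F.filter (· ∈ ω)).card}) *
        (prodBernoulli p).real {ω : Set ι | k + 1 ≤ (F.filter (· ∈ ω)).card} ≤
      (prodBernoulli p).real (U ∩ {ω : Set ι | k + 1 ≤ (F.filter (· ∈ ω)).card}) *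
        (prodBernoulli p).real {ω : Set ι | k ≤ (F.filter (· ∈ ω)).card} := by
  rw [real_inter_upper_succ p F U k, real_upper_succ p F k]
  have h := real_inter_layer_mul_upper_le p F hU hUF k (k + 1) (Nat.le_succ k)
  nlinarith [h]

/-! ## The upper drift of a dominated event generated below the upper ball -/

/-- **UPPER MONO-B** (memo S4): for `e ∉ F`, an increasing `insert e F`-determined, `e`-dominated event `B` generated below level `r+1`, and ANY
product measure:  `μ{r+1 ≤ N_F}·μ(B¹ ∩ {r ≤ N_F}) ≤ μ{r ≤ N_F}·μ(B⁰ ∩ {r+1 ≤ N_F})`  (`B¹ = {ω | insert e ω ∈ B}`, `B⁰ = {ω | ω ∖ {e} ∈ B}`), i.e.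
`μ(B¹ | N_F ≥ r) ≤ μ(B⁰ | N_F ≥ r+1)` — the sign `ΔB^U ≤ 0` of the upper correction term in the two-sided pivot identity. [this work] -/
theorem upperDrift_nonpos_of_dominated (p : ι → unitInterval) {F : Finset ι} {e : ι} (heF : e ∉ F) (r : ℕ) {B : Set (Set ι)}
    (hB : IsUpperSet B) (hBF : DeterminedBy B (↑(insert e F) : Set ι))
    (hdom : ∀ ω ∈ B, e ∈ ω → ∀ j ∈ F, j ∉ ω → (ω \ {e}) ∪ {j} ∈ B)
    (hgenb : ∀ ω ∈ B, ∃ z ∈ B, z ⊆ ω ∧ ((insert e F).filter (· ∈ z)).card ≤ r) :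
    (prodBernoulli p).real {ω : Set ι | r + 1 ≤ (F.filter (· ∈ ω)).card} *
        (prodBernoulli p).real ({ω : Set ι | insert e ω ∈ B} ∩ {ω : Set ι | r ≤ (F.filter (· ∈ ω)).card}) ≤
      (prodBernoulli p).real {ω : Set ι | r ≤ (F.filter (· ∈ ω)).card} *
        (prodBernoulli p).real ({ω : Set ι | ω \ {e} ∈ B} ∩ {ω : Set ι | r + 1 ≤ (F.filter (· ∈ ω)).card}) := by
  have hcoe : (↑(insert e F) : Set ι) \ {e} = ↑F := by
    ext i
    simp only [Set.mem_sdiff, Finset.coe_insert, Set.mem_insert_iff, Finset.mem_coe, Set.mem_singleton_iff]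
    constructor
    · rintro ⟨h | h, hne⟩
      · exact absurd h hne
      · exact h
    · intro h
      exact ⟨Or.inr h, fun hie => heF (hie ▸ h)⟩
  have hB0F : DeterminedBy {ω : Set ι | ω \ {e} ∈ B} (↑F : Set ι) := hcoe ▸ determinedBy_section_sdiff hBF e
  have hB0 : IsUpperSet {ω : Set ι | ω \ {e} ∈ B} := isUpperSet_section_sdiff hB e
  rw [section_inter_upper_eq_of_dominated_genBelow heF hB hdom hgenb le_rfl]
  have h := real_inter_upper_mul_le p F hB0 hB0F r
  nlinarith [h]

end SahiOneStep

end Summit.CriticalPhenomena.PercolationContinuityZ3.Theorems
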